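import Literature.Geometry.Riemannian.DominatedMetricComplete
import Literature.Geometry.Riemannian.RiemannianCoveringCriterion
import Literature.Geometry.Riemannian.ExpMapGlobalSmooth
import Literature.Geometry.Riemannian.RoundSphere
import Literature.Geometry.Lorentzian.SpacetimePositiveMassRigidityProofs
import Literature.Geometry.Lorentzian.SpacelikeGraphMinkowski
import Literature.Geometry.Lorentzian.CauchyProblemProofs
import Literature.Geometry.Lorentzian.IsometryProofs
import Literature.Topology.FourManifolds.InverseFunctionTheorem
import Mathlib.Topology.Homotopy.Lifting
import Mathlib.Analysis.Convex.Contractible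
import Mathlib.AlgebraicTopology.FundamentalGroupoid.SimplyConnected
import HarnessLib

/-!
# Complete spacelike hypersurfaces of Minkowski space-time are entire graphs; uniformly
# spacelike ones are Cauchy hypersurfaces

The rigid positive energy theorem (Beig–Chruściel, J. Math. Phys. 37 (1996) 1939–1961,
Thm. 4.1, case `m = 0`; vendored as the named fact `positive_mass_rigidity_spacetime`,
`SpacetimePositiveMassRigidity.lean`) ends (§4, last paragraph of the proof): *"`Σ` can be
isometrically embedded in `ℝ⁴` … As `Σ̃` is a Cauchy surface for `M̄`, it is necessarily a
graph over a spacelike plane `t = 0` in `(ℝ⁴, η)` … Moreover `i(Σ)` is an asymptotically flat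
Cauchy surface in `(ℝ⁴, η)`."* The local geometric half of that proof is in the tree
(`TranslationalKIDImmersion.lean`, `KIDPatchImmersion.lean`: translational Killing initial data
integrate to spacelike isometric immersions into `(ℝ⁴, η)` with `K_ν = k`), as is the fact that
uniformly spacelike entire graphs are Cauchy hypersurfaces
(`Minkowski.isCauchyHypersurface_range_graph_of_fderiv`, `SpacetimePositiveMassRigidityProofs.lean`).
This file proves the GLOBAL step in between, for an arbitrary connected Hausdorff `3`-manifold
`X`, a smooth Riemannian metric `h` on `X` with geodesically complete Levi-Civita connection,
and a smooth `f : X → ℝ⁴` with `f^*η = h`: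

* `Minkowski.injective_mfderiv_spatial_comp` — the spatial projection `f̲ = π ∘ f : X → ℝ³` is
  an immersion (a spacelike tangent plane contains no vertical vector);
* `Minkowski.exists_diffeomorph_eq_spatial` — **`f̲` is a diffeomorphism `X ≅ ℝ³`**: its
  pulled-back Euclidean metric dominates `h` (`η(w, w) ≤ ‖w̲‖²`), hence is geodesically
  complete with `h` (Hopf–Rinow, `isGeodesicallyComplete_of_val_le`); a local isometry from a
  complete manifold onto the connected `ℝ³` is a surjective covering map (Lee 2018, Thm. 6.23,
  `CartanHadamard.surjective_and_isCoveringMap_of_isGeodesicallyComplete`); it is injective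
  because `ℝ³` is simply connected (the identity lifts to a global section,
  `IsCoveringMap.existsUnique_continuousMap_lifts`, which is a two-sided inverse by uniqueness
  of lifts from the connected `X`, `IsCoveringMap.eq_of_comp_eq`); and a bijective local
  diffeomorphism is a diffeomorphism (`IsLocalDiffeomorph.diffeomorphOfBijective`);
* `Minkowski.exists_diffeomorph_graph` — hence **`f(X)` is the entire graph** of the smooth
  function `u = t ∘ f ∘ f̲⁻¹ : ℝ³ → ℝ`, `f x = (u(f̲ x), f̲ x)`;
* `Minkowski.exists_diffeomorph_graph_of_uniform` — if `f` is **uniformly spacelike**,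
  `|dt(df v)| ≤ θ ‖(df v)̲‖` for all tangent vectors, then `‖du‖ ≤ θ` everywhere;
* `Minkowski.isCauchyHypersurface_range_of_complete` — so for `θ < 1` **the image of `f` is a
  Cauchy hypersurface** of `(ℝ⁴, η, ∂ₜ)`.

The completeness hypothesis cannot be dropped (a bounded disc of `{t = 0}` is uniformly
spacelike), nor can the uniformity `θ < 1` in the last statement (the hyperboloid
`t = √(1 + |x|²)` is complete and an entire graph, but not a Cauchy hypersurface). In the
rigidity theorem the uniform bound is the boundedness of the lapse `N₀ = −η(∂₀, ν)` of the
asymptotically translational Killing field (`θ² = 1 − (sup N₀)⁻²`). The packaging of these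
data into `∃ 𝒟 : CauchyDevelopment D, 𝒟.toSpacetime = Minkowski.spacetime` is
`CompleteSpacelikeImmersionCauchy.lean`. Theorems only; no definitions, no named facts
(D-0026).

## References

* R. Beig, P. T. Chruściel, *Killing vectors in asymptotically flat space-times. I.
  Asymptotically translational Killing vectors and the rigid positive energy theorem*, J. Math.
  Phys. 37 (1996) 1939–1961, arXiv:gr-qc/9510015: Thm. 4.1 and its proof, §4 (last
  paragraph). [BeigChrusciel1996]
* S.-Y. Cheng, S.-T. Yau, *Maximal space-like hypersurfaces in the Lorentz–Minkowski spaces*,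
  Ann. of Math. 104 (1976) 407–419, §1 (closed spacelike hypersurfaces are entire graphs).
* J. M. Lee, *Introduction to Riemannian Manifolds*, 2nd ed. (2018), Thm. 6.23. [Lee2018]
* B. O'Neill, *Semi-Riemannian geometry*, Academic Press 1983, Ch. 3, p. 55; Ch. 5, Thm. 21
  (Hopf–Rinow), p. 142; Ch. 7, Cor. 29. [ONeill1983]
-/

noncomputable section

open Bundle Set Function Filter Manifold
open scoped Manifold ContDiff Topology InnerProductSpace

namespace Literature.Geometry.Lorentzian

namespace Minkowski

open Literature.Geometry.Riemannian

/-! ### The Minkowski form in the time–space splitting -/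

/-- `η(v, v) = −(v⁰)² + ‖v̲‖²` in the splitting `E4 = ℝ × ℝ³` (O'Neill 1983, Ch. 3, p. 55:
`ℝ⁴₁`). [cite: ONeill1983, Ch. 3, p. 55] -/
theorem bilin_self_eq_time_spatial (v : E4) :
    bilin v v = -(E4.time v) ^ 2 + ‖E4.spatial v‖ ^ 2 := by
  rw [bilin_apply, E4.time_apply, EuclideanSpace.norm_sq_eq]
  simp only [E4.spatial_apply, Real.norm_eq_abs, sq, abs_mul_abs_self]

/-- `η(v, v) ≤ ‖v̲‖²`: the Minkowski square of a vector is at most the Euclidean square of its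
spatial part. [cite: ONeill1983, Ch. 3, p. 55] -/
theorem bilin_self_le_norm_spatial_sq (v : E4) : bilin v v ≤ ‖E4.spatial v‖ ^ 2 := by
  rw [bilin_self_eq_time_spatial]
  nlinarith [sq_nonneg (E4.time v)]

/-! ### The projection of an immersed hypersurface to `{t = 0}` -/

section General

variable {X : Type*} [TopologicalSpace X] [ChartedSpace E3 X] [IsManifold (𝓡 3) ∞ X]
  {f : X → E4}

omit [IsManifold (𝓡 3) ∞ X] in
/-- Chain rule: the differential of the spatial projection `x ↦ f(x)̲` of a map `f : X → ℝ⁴` is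
the spatial projection of `df`. [folklore] -/
theorem mfderiv_spatial_comp_apply {x : X} (hfx : MDifferentiableAt (𝓡 3) 𝓘(ℝ, E4) f x)
    (v : TangentSpace (𝓡 3) x) :
    mfderiv (𝓡 3) 𝓘(ℝ, E3) (fun x ↦ E4.spatial (f x)) x v =
      E4.spatial (mfderiv (𝓡 3) 𝓘(ℝ, E4) f x v) := by
  have h := (E4.spatial.hasMFDerivAt (x := f x)).comp x hfx.hasMFDerivAt
  rw [show (fun x ↦ E4.spatial (f x)) = E4.spatial ∘ f from rfl, h.mfderiv]
  rfl

variable {h : PseudoRiemannianMetric (𝓡 3) ∞ E3 (TangentSpace (𝓡 3) : X → Type _)}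

/-- **The projection to `{t = 0}` of a spacelike immersed hypersurface is an immersion.** If
`f : X³ → (ℝ⁴, η)` is differentiable at `x` and `f^*η = h` at `x` with `h_x` positive definite,
then `d(f̲)_x = (df_x)̲` is injective: a tangent vector with vanishing spatial part has
`h(v, v) = η(df v, df v) = −(dt(df v))² ≤ 0`. (O'Neill 1983, Ch. 5, p. 142: a spacelike
tangent plane contains no causal vector.) [cite: ONeill1983, Ch. 5, p. 142] -/
theorem injective_mfderiv_spatial_comp {x : X} (hfx : MDifferentiableAt (𝓡 3) 𝓘(ℝ, E4) f x)
    (hpos : ∀ v : TangentSpace (𝓡 3) x, v ≠ 0 → 0 < h.val x v v)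
    (hiso : ∀ v : TangentSpace (𝓡 3) x,
      bilin (mfderiv (𝓡 3) 𝓘(ℝ, E4) f x v) (mfderiv (𝓡 3) 𝓘(ℝ, E4) f x v) = h.val x v v) :
    Injective (mfderiv (𝓡 3) 𝓘(ℝ, E3) (fun x ↦ E4.spatial (f x)) x) := by
  refine (injective_iff_map_eq_zero _).2 fun v hv ↦ ?_
  rw [mfderiv_spatial_comp_apply hfx] at hv
  by_contra hne
  set w : E4 := mfderiv (𝓡 3) 𝓘(ℝ, E4) f x v with hw
  have hv' : E4.spatial w = 0 := hv
  have h1 : 0 < bilin w w := (hpos v hne).trans_eq (hiso v).symm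
  rw [bilin_self_eq_time_spatial, hv', norm_zero] at h1
  nlinarith [sq_nonneg (E4.time w)]

/-! ### Complete spacelike immersed hypersurfaces project diffeomorphically onto `{t = 0}` -/

variable [T2Space X] [ConnectedSpace X] [h.HasLeviCivita]

/-- **A complete spacelike immersed hypersurface of Minkowski space-time projects
diffeomorphically onto the hyperplane `{t = 0}`.** Let `X` be a connected Hausdorff `3`-manifold,
`h` a smooth Riemannian metric on `X` whose Levi-Civita connection is geodesically complete, and
`f : X → (ℝ⁴, η)` a smooth map with `f^*η = h` (an isometric, hence spacelike, immersion). Then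
the spatial projection `x ↦ f(x)̲ ∈ ℝ³` is a diffeomorphism `X ≅ ℝ³`. Proof: it is an
equidimensional immersion (`injective_mfderiv_spatial_comp`) whose pulled-back Euclidean metric
dominates `h` (`η(w, w) ≤ ‖w̲‖²`), hence is geodesically complete with `h` (Hopf–Rinow,
`isGeodesicallyComplete_of_val_le`); a local isometry from a complete manifold onto the
connected `ℝ³` is a covering map (Lee 2018, Thm. 6.23;
`CartanHadamard.surjective_and_isCoveringMap_of_isGeodesicallyComplete`), injective because
`ℝ³` is simply connected (the identity of `ℝ³` lifts to a section, which by uniqueness of lifts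
from the connected `X` is a two-sided inverse), and a bijective local diffeomorphism is a
diffeomorphism. This is the step "`Σ̃` … is necessarily a graph over a spacelike plane `t = 0`
in `(ℝ⁴, η)`" of the proof of the rigid positive energy theorem, Beig–Chruściel, J. Math.
Phys. 37 (1996), Thm. 4.1, §4 (last paragraph), in the classical form "complete spacelike
hypersurfaces of Minkowski space are entire graphs" (cf. Cheng–Yau, Ann. of Math. 104 (1976),
§1; Harris, *Closed and complete spacelike hypersurfaces in Minkowski space*, Class. Quantum
Grav. 5 (1988), Thm. 2).
[cite: BeigChrusciel1996, proof of Thm. 4.1, §4 (last paragraph)] -/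
theorem exists_diffeomorph_eq_spatial (hf : ContMDiff (𝓡 3) 𝓘(ℝ, E4) ∞ f)
    (hpos : h.IsRiemannian)
    (hiso : ∀ (x : X) (v w : TangentSpace (𝓡 3) x),
      bilin (mfderiv (𝓡 3) 𝓘(ℝ, E4) f x v) (mfderiv (𝓡 3) 𝓘(ℝ, E4) f x w) = h.val x v w)
    (hc : IsGeodesicallyComplete h.leviCivita) :
    ∃ Φ : Diffeomorph (𝓡 3) 𝓘(ℝ, E3) X E3 ∞, ∀ x, Φ x = E4.spatial (f x) := by
  haveI : Fact ((1 : ℕ∞ω) ≤ ∞) := ⟨by exact_mod_cast (le_top : (1 : ℕ∞) ≤ ⊤)⟩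
  have hk : ((1 : ℕ∞) : ℕ∞ω) + 1 ≤ ∞ := by exact_mod_cast (le_top : ((1 : ℕ∞) + 1) ≤ ⊤)
  -- the projection is a smooth equidimensional immersion
  set F : X → E3 := fun x ↦ E4.spatial (f x) with hFdef
  have hFs : ContMDiff (𝓡 3) 𝓘(ℝ, E3) ∞ F := E4.spatial.contMDiff.comp hf
  have hF : ContMDiff (𝓡 3) 𝓘(ℝ, E3) (∞ + 1) F := hFs.of_le (le_of_eq (by rfl))
  have hfx : ∀ x, MDifferentiableAt (𝓡 3) 𝓘(ℝ, E4) f x := fun x ↦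
    hf.mdifferentiableAt (by simp) (x := x)
  have hF' : ∀ x, Injective (mfderiv (𝓡 3) 𝓘(ℝ, E3) F x) := fun x ↦
    injective_mfderiv_spatial_comp (hfx x) (hpos x) fun v ↦ hiso x v v
  have hdim : Module.finrank ℝ E3 = Module.finrank ℝ E3 := rfl
  have hpb : PseudoRiemannianMetric.contMDiff_pullbackBilin 𝓘(ℝ, E3) E3 (𝓡 3) X ∞ :=
    PseudoRiemannianMetric.contMDiff_pullbackBilin_holds
  -- the pulled-back Euclidean metric dominates `h`, hence is Riemannian and complete
  set G := (euclideanMetric E3).comap hpb F hF hF' hdim with hGdef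
  have hGval : ∀ (x : X) (v : TangentSpace (𝓡 3) x),
      G.val x v v = ‖(E4.spatial (mfderiv (𝓡 3) 𝓘(ℝ, E4) f x v) : E3)‖ ^ 2 := by
    intro x v
    have h1 : G.val x v v = @inner ℝ E3 _ (E4.spatial (mfderiv (𝓡 3) 𝓘(ℝ, E4) f x v))
        (E4.spatial (mfderiv (𝓡 3) 𝓘(ℝ, E4) f x v)) := by
      rw [hGdef, PseudoRiemannianMetric.val_comap, pullbackBilin_apply, euclideanMetric_apply,
        mfderiv_spatial_comp_apply (hfx x)]
      rfl
    rw [h1, real_inner_self_eq_norm_sq]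
  have hle : ∀ (x : X) (v : TangentSpace (𝓡 3) x), h.val x v v ≤ G.val x v v := by
    intro x v
    rw [hGval, ← hiso x v v]
    exact bilin_self_le_norm_spatial_sq _
  have hG : G.IsRiemannian := fun x v hv ↦ lt_of_lt_of_le (hpos x v hv) (hle x v)
  haveI := G.hasLeviCivita
  have hcG : IsGeodesicallyComplete G.leviCivita :=
    isGeodesicallyComplete_of_val_le (g₁ := h) (g₂ := G) le_rfl hpos hG hle hc
  -- the Euclidean metric of `ℝ³` is complete; the covering criterion
  haveI := (euclideanMetric E3).hasLeviCivita
  haveI : CovariantDerivative.ContMDiffCovariantDerivative (euclideanMetric E3).leviCivita ∞ :=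
    contMDiffCovariantDerivative_leviCivita_infty _ le_rfl
  haveI : CovariantDerivative.ContMDiffCovariantDerivative (euclideanMetric E3).leviCivita 1 :=
    ⟨(euclideanMetric E3).isLocallyContMDiff_leviCivita_holds 1 hk univ isOpen_univ⟩
  haveI : CovariantDerivative.ContMDiffCovariantDerivative G.leviCivita ∞ :=
    contMDiffCovariantDerivative_leviCivita_infty _ le_rfl
  haveI : CovariantDerivative.ContMDiffCovariantDerivative G.leviCivita 1 :=
    ⟨G.isLocallyContMDiff_leviCivita_holds 1 hk univ isOpen_univ⟩
  have hcE : IsGeodesicallyComplete (euclideanMetric E3).leviCivita :=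
    ModelSpace.isGeodesicallyComplete_of_val_eq (g := euclideanMetric E3)
      (G₀ := (innerSL ℝ (E := E3) : E3 →L[ℝ] E3 →L[ℝ] ℝ)) fun _ ↦ rfl
  obtain ⟨hsurj, hcov⟩ :=
    CartanHadamard.surjective_and_isCoveringMap_of_isGeodesicallyComplete (g := euclideanMetric E3)
      (hpb := hpb) (hf := hF) (hf' := hF') (hdim := hdim) hcG hcE
  -- injectivity: the identity of the simply connected `ℝ³` lifts to a global section
  obtain ⟨x₀⟩ := (inferInstance : Nonempty X)
  obtain ⟨s, ⟨hs₀, hsF⟩, -⟩ :=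
    hcov.existsUnique_continuousMap_lifts (ContinuousMap.id E3) (F x₀) x₀ rfl
  have hsec : (s : E3 → X) ∘ F = id := by
    refine hcov.eq_of_comp_eq (s.continuous.comp hFs.continuous) continuous_id ?_ x₀ hs₀
    change F ∘ (s ∘ F) = F ∘ id
    rw [← Function.comp_assoc, hsF]
    rfl
  have hinj : Injective F := fun a b hab ↦ by
    have ha := congrFun hsec a
    have hb := congrFun hsec b
    simp only [comp_apply, id_eq] at ha hb
    rw [← ha, ← hb, hab]
  -- a bijective local diffeomorphism is a diffeomorphism
  have hloc : IsLocalDiffeomorph (𝓡 3) 𝓘(ℝ, E3) ∞ F := fun x ↦ by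
    set L : E3 ≃ₗ[ℝ] E3 := mfderivEquivOfInjective (I := 𝓘(ℝ, E3)) (I' := 𝓡 3) F x (hF' x) hdim
    refine Literature.Topology.FourManifolds.isLocalDiffeomorphAt_of_mfderiv isOpen_univ
      (mem_univ x) hFs.contMDiffOn (by exact_mod_cast le_top) L.toContinuousLinearEquiv ?_
    ext u
    rfl
  exact ⟨hloc.diffeomorphOfBijective ⟨hinj, hsurj⟩, fun x ↦ rfl⟩


/-! ### The hypersurface is an entire graph over `{t = 0}` -/

/-- **Complete spacelike hypersurfaces of Minkowski space-time are entire graphs.** In the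
setting of `exists_diffeomorph_eq_spatial` (connected Hausdorff `X³`, complete Riemannian `h`,
smooth `f : X → (ℝ⁴, η)` with `f^*η = h`): with the diffeomorphism `Φ = f̲ : X ≅ ℝ³` and the
smooth function `u = t ∘ f ∘ Φ⁻¹ : ℝ³ → ℝ` one has `f(x) = (u(Φ x), Φ x)` for all `x`, so that
the image of `f` is the entire graph `{(u(y), y) | y ∈ ℝ³}` (Beig–Chruściel 1996, proof of
Thm. 4.1, §4, last paragraph: "necessarily a graph over a spacelike plane `t = 0`").
[cite: BeigChrusciel1996, proof of Thm. 4.1, §4 (last paragraph)] -/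
theorem exists_diffeomorph_graph (hf : ContMDiff (𝓡 3) 𝓘(ℝ, E4) ∞ f)
    (hpos : h.IsRiemannian)
    (hiso : ∀ (x : X) (v w : TangentSpace (𝓡 3) x),
      bilin (mfderiv (𝓡 3) 𝓘(ℝ, E4) f x v) (mfderiv (𝓡 3) 𝓘(ℝ, E4) f x w) = h.val x v w)
    (hc : IsGeodesicallyComplete h.leviCivita) :
    ∃ (Φ : Diffeomorph (𝓡 3) 𝓘(ℝ, E3) X E3 ∞) (u : E3 → ℝ), ContDiff ℝ ∞ u ∧
      (∀ x, Φ x = E4.spatial (f x)) ∧ (∀ y, u y = E4.time (f (Φ.symm y))) ∧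
      (∀ x, f x = E4.ofTimeSpace (u (Φ x)) (Φ x)) ∧
      range f = range fun y : E3 ↦ E4.ofTimeSpace (u y) y := by
  obtain ⟨Φ, hΦ⟩ := exists_diffeomorph_eq_spatial hf hpos hiso hc
  have hfu : ∀ x, f x = E4.ofTimeSpace (E4.time (f (Φ.symm (Φ x)))) (Φ x) := fun x ↦ by
    rw [Φ.symm_apply_apply, hΦ, E4.ofTimeSpace_time_spatial]
  refine ⟨Φ, fun y ↦ E4.time (f (Φ.symm y)), ?_, hΦ, fun _ ↦ rfl, hfu, ?_⟩
  · -- smoothness of `u = dt ∘ f ∘ Φ⁻¹`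
    have h1 : ContMDiff 𝓘(ℝ, E3) 𝓘(ℝ, ℝ) ∞ fun y ↦ E4.time (f (Φ.symm y)) :=
      (E4.dx 0).contMDiff.comp (hf.comp Φ.symm.contMDiff)
    exact contMDiff_iff_contDiff.1 h1
  · ext p
    constructor
    · rintro ⟨x, rfl⟩
      exact ⟨Φ x, (hfu x).symm⟩
    · rintro ⟨y, rfl⟩
      refine ⟨Φ.symm y, ?_⟩
      rw [hfu (Φ.symm y), Φ.apply_symm_apply]

/-- **Uniformly spacelike complete hypersurfaces are entire graphs of uniformly Lipschitz
functions.** If moreover `f` is *uniformly spacelike*, `|dt(df v)| ≤ θ ‖(df v)̲‖` for all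
tangent vectors `v` with a constant `θ` (for the hypersurfaces of the rigid positive energy
theorem: the lapse `N₀ = −η(∂ₜ, ν)` of `∂ₜ` is bounded, `θ² = 1 − (sup N₀)⁻²`), then the graph
function satisfies `‖du‖ ≤ θ` everywhere: `du_y(w) = dt(df V)` and `w = (df V)̲` for the vector
`V = dΦ⁻¹_y w`. [cite: BeigChrusciel1996, proof of Thm. 4.1, §4 (last paragraph)] -/
theorem exists_diffeomorph_graph_of_uniform (hf : ContMDiff (𝓡 3) 𝓘(ℝ, E4) ∞ f)
    (hpos : h.IsRiemannian)
    (hiso : ∀ (x : X) (v w : TangentSpace (𝓡 3) x),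
      bilin (mfderiv (𝓡 3) 𝓘(ℝ, E4) f x v) (mfderiv (𝓡 3) 𝓘(ℝ, E4) f x w) = h.val x v w)
    (hc : IsGeodesicallyComplete h.leviCivita) {θ : NNReal}
    (hus : ∀ (x : X) (v : TangentSpace (𝓡 3) x),
      |E4.time (mfderiv (𝓡 3) 𝓘(ℝ, E4) f x v)| ≤
        θ * ‖E4.spatial (mfderiv (𝓡 3) 𝓘(ℝ, E4) f x v)‖) :
    ∃ (Φ : Diffeomorph (𝓡 3) 𝓘(ℝ, E3) X E3 ∞) (u : E3 → ℝ), ContDiff ℝ ∞ u ∧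
      (∀ x, Φ x = E4.spatial (f x)) ∧ (∀ x, f x = E4.ofTimeSpace (u (Φ x)) (Φ x)) ∧
      range f = range (fun y : E3 ↦ E4.ofTimeSpace (u y) y) ∧ ∀ y, ‖fderiv ℝ u y‖₊ ≤ θ := by
  obtain ⟨Φ, u, hu, hΦ, huf, hfu, hrange⟩ := exists_diffeomorph_graph hf hpos hiso hc
  refine ⟨Φ, u, hu, hΦ, hfu, hrange, fun y ↦ ?_⟩
  -- the parametrisation `ψ = f ∘ Φ⁻¹ : ℝ³ → ℝ⁴` of the graph, `ψ y = (u y, y)`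
  set ψ : E3 → E4 := fun y ↦ f (Φ.symm y) with hψdef
  have hψs : ContMDiff 𝓘(ℝ, E3) 𝓘(ℝ, E4) ∞ ψ := hf.comp Φ.symm.contMDiff
  have hψd : Differentiable ℝ ψ := (contMDiff_iff_contDiff.1 hψs).differentiable (by simp)
  have hud : Differentiable ℝ u := hu.differentiable (by simp)
  set x : X := Φ.symm y with hxdef
  have hfx : MDifferentiableAt (𝓡 3) 𝓘(ℝ, E4) f x := hf.mdifferentiableAt (by simp)
  -- `dψ_y w = df_x (dΦ⁻¹_y w)`
  have hcomp : HasMFDerivAt 𝓘(ℝ, E3) 𝓘(ℝ, E4) ψ y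
      ((mfderiv (𝓡 3) 𝓘(ℝ, E4) f x).comp (mfderiv 𝓘(ℝ, E3) (𝓡 3) Φ.symm y)) :=
    hfx.hasMFDerivAt.comp y (Φ.symm.mdifferentiable (by simp) y).hasMFDerivAt
  have hdψ : ∀ w : E3, fderiv ℝ ψ y w =
      mfderiv (𝓡 3) 𝓘(ℝ, E4) f x (mfderiv 𝓘(ℝ, E3) (𝓡 3) Φ.symm y w) := by
    intro w
    rw [← mfderiv_eq_fderiv, hcomp.mfderiv]
    rfl
  -- `u = dt ∘ ψ` and `(ψ)̲ = id`
  have hu_eq : u = fun y ↦ E4.dx 0 (ψ y) := funext fun y ↦ huf y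
  have hsp : ∀ y, E4.spatial (ψ y) = y := fun y ↦ by
    change E4.spatial (f (Φ.symm y)) = y
    rw [← hΦ, Φ.apply_symm_apply]
  have hdu : ∀ w : E3, fderiv ℝ u y w = E4.time (fderiv ℝ ψ y w) := by
    intro w
    rw [hu_eq, show (fun y ↦ E4.dx 0 (ψ y)) = (E4.dx 0) ∘ ψ from rfl,
      ((E4.dx 0).hasFDerivAt.comp y (hψd y).hasFDerivAt).fderiv]
    rfl
  have hdsp : ∀ w : E3, E4.spatial (fderiv ℝ ψ y w) = w := by
    intro w
    have h1 : HasFDerivAt (fun y ↦ E4.spatial (ψ y)) (E4.spatial.comp (fderiv ℝ ψ y)) y :=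
      E4.spatial.hasFDerivAt.comp y (hψd y).hasFDerivAt
    have h2 : HasFDerivAt (fun y ↦ E4.spatial (ψ y)) (ContinuousLinearMap.id ℝ E3) y := by
      have : (fun y ↦ E4.spatial (ψ y)) = id := funext hsp
      rw [this]
      exact hasFDerivAt_id y
    have h3 := h1.unique h2
    exact congrArg (fun L : E3 →L[ℝ] E3 ↦ L w) h3
  -- the bound
  have hb : ∀ w : E3, ‖fderiv ℝ u y w‖ ≤ θ * ‖w‖ := by
    intro w
    rw [Real.norm_eq_abs, hdu]
    have h1 := hus x (mfderiv 𝓘(ℝ, E3) (𝓡 3) Φ.symm y w)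
    rwa [← hdψ, hdsp] at h1
  have hop : ‖fderiv ℝ u y‖ ≤ θ := ContinuousLinearMap.opNorm_le_bound _ θ.coe_nonneg hb
  exact_mod_cast hop

/-- **A complete, uniformly spacelike hypersurface of Minkowski space-time is a Cauchy
hypersurface.** In the setting of `exists_diffeomorph_graph_of_uniform` with `θ < 1`, the image
of `f` — the entire graph of a function with `‖du‖ ≤ θ < 1` — is met exactly once by every
endless timelike curve of `(ℝ⁴, η, ∂ₜ)` (`isCauchyHypersurface_range_graph_of_fderiv`): the
clause "`i(Σ)` is an asymptotically flat Cauchy surface in `(ℝ⁴, η)`" of Beig–Chruściel, J.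
Math. Phys. 37 (1996), Thm. 4.1, in the form in which the geometric half of its proof delivers
it (completeness of the data and boundedness of the lapse). [cite: BeigChrusciel1996, Thm. 4.1 (last clause) and its proof, §4] -/
theorem isCauchyHypersurface_range_of_complete (hf : ContMDiff (𝓡 3) 𝓘(ℝ, E4) ∞ f)
    (hpos : h.IsRiemannian)
    (hiso : ∀ (x : X) (v w : TangentSpace (𝓡 3) x),
      bilin (mfderiv (𝓡 3) 𝓘(ℝ, E4) f x v) (mfderiv (𝓡 3) 𝓘(ℝ, E4) f x w) = h.val x v w)
    (hc : IsGeodesicallyComplete h.leviCivita) {θ : NNReal} (hθ : θ < 1)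
    (hus : ∀ (x : X) (v : TangentSpace (𝓡 3) x),
      |E4.time (mfderiv (𝓡 3) 𝓘(ℝ, E4) f x v)| ≤
        θ * ‖E4.spatial (mfderiv (𝓡 3) 𝓘(ℝ, E4) f x v)‖) :
    spacetime.metric.IsCauchyHypersurface spacetime.timeOrientation
      (range (α := spacetime.carrier) f) := by
  obtain ⟨Φ, u, hu, -, -, hrange, hb⟩ := exists_diffeomorph_graph_of_uniform hf hpos hiso hc hus
  have hrange' : range (α := spacetime.carrier) f =
      range (α := spacetime.carrier) fun y : E3 ↦ E4.ofTimeSpace (u y) y := hrange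
  rw [hrange']
  exact isCauchyHypersurface_range_graph_of_fderiv hθ (hu.differentiable (by simp)) hb

end General

end Minkowski

end Literature.Geometry.Lorentzian

end
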